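import Summits.KontsevichZagierPeriods.KontsevichZagierPeriods.Theorems.AbelContractionRealHyperellipticSectorDefs

/-!
# Route AbelContraction — `RealHyperellipticSector` (crux stmt-KontsevichZagierPeriods-12475): signs on the ovals

Helper file of the line `Lines/birth.lean` (registered brick `engine_oval_signs` of the stub
`stub_engine`, `--supports` the crux). For an M-polynomial with real simple branch points
`e 0 < e 1 < ⋯ < e (2g + 1)` the separating pencil factors `q = lc · N · D` with
`N(t) = ∏_{k ≤ g} (t − e (2k))` (even-indexed branch points) and `D(t) = ∏_{k ≤ g} (t − e (2k + 1))`
(odd-indexed ones). On the `j`-th oval `O_j = (e (2j), e (2j + 1))` (`j ≤ g`) the factor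
`t − e (2k)` is positive iff `k ≤ j` and `t − e (2k + 1)` is positive iff `k < j`, so `N` has exactly
`g − j` negative factors and `D` exactly `g − j + 1`:

* `OvalSigns.signed_prod_pos`: a product over `range n` of `m` positive factors followed by `n − m`
  negative ones has the sign `(−1)^(n − m)`;
* `engine_oval_signs`: `0 < (−1)^(g − j) · N(t)` and `0 < (−1)^(g − j + 1) · D(t)` for `t ∈ O_j`.

References: M. Kontsevich, D. Zagier, *Periods* (2001), §1.2 [KontsevichZagier2001];
B. Gross, J. Harris, *Real algebraic curves*, Ann. Sci. ÉNS 14 (1981), §3 [GrossHarris1981].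
No definitions are introduced.
-/

noncomputable section

open Set
open Literature.NumberTheory.Transcendental

namespace Summit.KontsevichZagierPeriods.AbelContraction.RealHyperellipticSector

/-- **Sign of a product with a block of negative factors**: if `f k > 0` for `k < m` and `f k < 0`
for `m ≤ k < n` (`m ≤ n`), then `0 < (−1)^(n − m) · ∏_{k < n} f k`. [folklore] -/
theorem OvalSigns.signed_prod_pos (f : ℕ → ℝ) (m : ℕ) (hpos : ∀ k < m, 0 < f k) :
    ∀ n, m ≤ n → (∀ k, m ≤ k → k < n → f k < 0) →
      0 < (-1 : ℝ) ^ (n - m) * ∏ k ∈ Finset.range n, f k := by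
  intro n hmn
  induction n, hmn using Nat.le_induction with
  | base =>
    intro _
    rw [Nat.sub_self, pow_zero, one_mul]
    exact Finset.prod_pos fun k hk => hpos k (Finset.mem_range.mp hk)
  | succ n hmn ih =>
    intro hneg
    have h1 : 0 < (-1 : ℝ) ^ (n - m) * ∏ k ∈ Finset.range n, f k :=
      ih fun k hk hkn => hneg k hk (Nat.lt_succ_of_lt hkn)
    have h2 : 0 < -f n := neg_pos.mpr (hneg n hmn (Nat.lt_succ_self n))
    rw [Finset.prod_range_succ, show n + 1 - m = n - m + 1 by omega, pow_succ]
    calc (0 : ℝ) < ((-1) ^ (n - m) * ∏ k ∈ Finset.range n, f k) * -f n := mul_pos h1 h2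
      _ = (-1) ^ (n - m) * -1 * ((∏ k ∈ Finset.range n, f k) * f n) := by ring

/-- **Signs of the even and odd branch-point products on an oval**: for strictly increasing
branch points `e` and `t` in the `j`-th oval `(e (2j), e (2j + 1))`, `j ≤ g`, one has
`0 < (−1)^(g − j) · ∏_{k ≤ g} (t − e (2k))` (the factors with `j < k ≤ g` are the negative ones) and
`0 < (−1)^(g − j + 1) · ∏_{k ≤ g} (t − e (2k + 1))` (the factors with `j ≤ k ≤ g` are the negative
ones). [cite: GrossHarris1981, §3] [folklore] -/
theorem engine_oval_signs : ∀ (g : ℕ) (e : ℕ → ℝ), StrictMono e → ∀ (j : ℕ), j ≤ g →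
    ∀ t ∈ Set.Ioo (e (2 * j)) (e (2 * j + 1)),
      0 < (-1 : ℝ) ^ (g - j) * ∏ k ∈ Finset.range (g + 1), (t - e (2 * k)) ∧
      0 < (-1 : ℝ) ^ (g - j + 1) * ∏ k ∈ Finset.range (g + 1), (t - e (2 * k + 1)) := by
  intro g e he j hj t ht
  rcases ht with ⟨ht1, ht2⟩
  refine ⟨?_, ?_⟩
  · have h : 0 < (-1 : ℝ) ^ (g + 1 - (j + 1)) * ∏ k ∈ Finset.range (g + 1), (t - e (2 * k)) :=
      OvalSigns.signed_prod_pos (fun k => t - e (2 * k)) (j + 1)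
        (fun k hk => sub_pos.mpr (lt_of_le_of_lt (he.monotone (by omega)) ht1)) (g + 1)
        (by omega) fun k hk _ => sub_neg.mpr (lt_of_lt_of_le ht2 (he.monotone (by omega)))
    rwa [show g + 1 - (j + 1) = g - j by omega] at h
  · have h : 0 < (-1 : ℝ) ^ (g + 1 - j) * ∏ k ∈ Finset.range (g + 1), (t - e (2 * k + 1)) :=
      OvalSigns.signed_prod_pos (fun k => t - e (2 * k + 1)) j
        (fun k hk => sub_pos.mpr (lt_trans (he (by omega : 2 * k + 1 < 2 * j)) ht1)) (g + 1)
        (by omega) fun k hk _ => sub_neg.mpr (lt_of_lt_of_le ht2 (he.monotone (by omega)))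
    rwa [show g + 1 - j = g - j + 1 by omega] at h

end Summit.KontsevichZagierPeriods.AbelContraction.RealHyperellipticSector

end
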